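/-
Copyright (c) 2026 the pub-hodgecm-mathlib formalisation cell (harness21).  Prover seat hodgecm-mathlib-K2E1b-p13 (g0),
Track B «K2-LIT» ∕ h413 (stmt-HodgeConjecture-24833), line K2_E1b «GKCohomologyU21», unit U4 «CLASS TRANSPORT», file #15:
payment of the socket `K2E1bGKCohomologyU21.U456.sig_K2E1bTypeClassesBotTransport` — VANISHING OF A HODGE PIECE `H^n_δ`
IS AN INVARIANT OF THE `(𝔤, K)`-ISOMORPHISM CLASS.  2026-09-03.
-/
import Summits.HodgeConjecture.HodgeConjecture.Theorems.F0P3bLocalAPacketsDefs   -- ★ `G21 = uFormGroup (Fin 2) (Fin 1)`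
import Literature.RepresentationTheory.GKModuleIrrClass                          -- ★ `GKIrrep`, `GKIrrClass.mk`, `mk_eq_mk_iff`
import Literature.RepresentationTheory.BorelWallach2000.UpqTypeFunctoriality      -- ★ `upqTypeClasses_eq_bot_iff_of_equiv`, `GKEquiv.comm𝔤∕commK`
import HarnessLib

/-!
# K2_E1b road (h413 = stmt-HodgeConjecture-24833), unit U4 «CLASS TRANSPORT», file #15:
# `H^n_δ = 0` transports along equality of classes in `GKIrrClass U(2,1)`

Cell `pub/hodgecm-mathlib` (D-0151), Track B (21-frontier RULING «PUSH BOTH» 2026-09-03, director req621∕req624, chair K2-lead,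
dealer K2E1b-plan), socket module
`Summits/HodgeConjecture/HodgeConjecture/Cruxes/H413/Lines/K2_E1b_GKCohomologyU21_U456_Cohomology.lean` (planner K2E1b-plan (g0),
sha16 a11d6b21314447a9), socket **`sig_K2E1bTypeClassesBotTransport`** (SIGS TABLE row #15, size M, FIRST RUNG): for two bundled
irreducible `(𝔲(2,1), K)`-modules `r₁ r₂ : GKIrrep G21` with the same class in ★ `GKIrrClass G21`, and any degree `n` and type `δ`,
`H^n_δ(r₁) = ⊥ → H^n_δ(r₂) = ⊥` (the tree's Hodge pieces ★ `upqTypeClasses … n δ ⊆ H^n(𝔤, K; ·)`).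

THE MATHEMATICS (pure functoriality, Borel–Wallach I §4.3 ∕ I Thm. 5.3 frame; Knapp–Vogan §II.4 for the classes).
* Equality of classes is `(𝔤, K)`-equivalence: ★ `GKIrrClass.mk_eq_mk_iff` (the class type is the quotient of `GKIrrep` by
  ★ `AreGKEquivalent = Nonempty (GKEquiv …)`), so a class equality yields an honest `(𝔤, K)`-isomorphism `e : r₁.V ≃ₗ[ℂ] r₂.V`
  intertwining `ρK` and `ρ𝔤` (★ `GKEquiv.commK`, ★ `GKEquiv.comm𝔤`, composed form).
* A `(𝔤, K)`-isomorphism induces `H^n(e) : H^n(𝔤, K; r₁) ≃ H^n(𝔤, K; r₂)` mapping `H^n_δ` ONTO `H^n_δ` (the type of a class is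
  read on the values of a cocycle, `ρ𝔤(z₀) f(v) = δ i · f(v)`, and `e` commutes with `z₀`): ★ `upqTypeClasses_eq_bot_iff_of_equiv`
  of ★ `UpqTypeFunctoriality` §51 gives `H^n_δ(r₁) = ⊥ ↔ H^n_δ(r₂) = ⊥` for any such `e`; we read it forwards.
* §1 `typeClassesBotTransport_iff` — the symmetric form (§2 in both directions).
* §2 **`typeClassesBotTransport`** — `sig_K2E1bTypeClassesBotTransport` TOKEN FOR TOKEN.
CONSUMER RECIPE (assemblies #19 `K2E1bWignerAssembly` ∕ #21 `K2E1bDsCarrierClass`, tier 0's `NoDegOneClass x` for `x = GKIrrClass.mk r`):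
after `intro M _ _ σK σ𝔤 hM hirr hx δ hδ` the goal `upqTypeClasses σK σ𝔤 hM.ad_compat 1 δ = ⊥` is CLOSED BY
`typeClassesBotTransport r ⟨M, σK, σ𝔤, hM, hirr⟩ hx.symm 1 δ ‹H^1_δ(r) = ⊥›` — ★ `GKIrrClass.ofModule M σK σ𝔤 hM hirr` is `mk` of the
bundle `⟨M, σK, σ𝔤, hM, hirr⟩` DEFINITIONALLY (★ `GKIrrClass.ofModule_eq_mk` is `rfl`), and the projections of the bundle reduce; no
unbundled restatement is filed here (it would need the file-level `LieRing.ofAssociativeRing` instance attribute to state `σ𝔤`).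
No hypothesis is idle: without `GKIrrClass.mk r₁ = GKIrrClass.mk r₂` the statement is false (take `r₁` with `H^1_1 = 0`, e.g. the
trivial class, and `r₂ = J⁺` with `H^1_1 ≠ 0`, ★ `archDegOneClass_spec`); the conclusion is not vacuous (`GKIrrep G21` is inhabited by
the T6 package's modules of record).

HONEST LABEL: HC_CM is proved only modulo the 7 printed citations (2 remaining named inputs: hLiu418 = stmt-HodgeConjecture-24832,
h413 = stmt-HodgeConjecture-24833) until rung 0 closes; this file is a `--supports stmt-HodgeConjecture-24833` helper (scaffold of the
K2_E1b road, consumed BY NAME by the assemblies #19 `K2E1bWignerAssembly` and #21 `K2E1bDsCarrierClass`) and retires nothing by itself.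

## References
* [BorelWallach2000] A. Borel, N. Wallach, *Continuous cohomology, discrete subgroups, and representations of reductive groups*,
  2nd ed., Math. Surveys Monogr. 67, AMS (2000), I §4.3 (functoriality of `Ext^q(U, ·)` in `𝒞_{𝔤,K}`), I Thm. 5.3, II §4.2 (3).
* [KnappVogan1995] A. W. Knapp, D. A. Vogan, *Cohomological Induction and Unitary Representations*, Princeton (1995), §II.4
  (infinitesimal equivalence classes of `(𝔤, K)`-modules).
-/

set_option autoImplicit false
-- the mandated namespace repeats the single-problem summit's segment (`HodgeConjecture.HodgeConjecture`)
set_option linter.dupNamespace false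

noncomputable section

open Literature.NumberTheory.Automorphic
open Literature.RepresentationTheory.BorelWallach2000
open Literature.RepresentationTheory.KonnoKonno2007 Literature.RepresentationTheory.KonnoKonno2007.RealDualPair
open Literature.RepresentationTheory.KonnoKonno2007.RealDualPair.UForm
open Summit.HodgeConjecture.HodgeConjecture.Cruxes.H413.F0P3bLocalAPacketsDefs (G21)

namespace Summit.HodgeConjecture.HodgeConjecture.Cruxes.H413.K2E1bTypeClassesBotTransport

/-! ## §2  The head (stated first: §1 is its corollary) -/

/-- **PAYMENT OF `sig_K2E1bTypeClassesBotTransport`** (socket #15 of unit U4 «CLASS TRANSPORT» of the K2_E1b road,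
`Cruxes/H413/Lines/K2_E1b_GKCohomologyU21_U456_Cohomology.lean`, TOKEN FOR TOKEN).
**Vanishing of a Hodge piece of classes is a class invariant.**  If two bundled irreducible `(𝔲(2,1), K)`-modules `r₁, r₂` have the
same class in `GKIrrClass U(2,1)`, then for every degree `n` and type `δ`, `H^n_δ(𝔤, K; r₁) = 0` implies `H^n_δ(𝔤, K; r₂) = 0`:
the class equality is a `(𝔤, K)`-equivalence `e` (★ `GKIrrClass.mk_eq_mk_iff`), and the cohomology isomorphism `H^n(e)` it induces
(functoriality of `H^*(𝔤, K; ·)`, Borel–Wallach I §4.3) carries `H^n_δ(r₁)` onto `H^n_δ(r₂)` because `e` commutes with `z₀`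
(★ `upqTypeClasses_eq_bot_iff_of_equiv`).
[cite: BorelWallach2000, I §4.3; I Thm. 5.3] [cite: KnappVogan1995, §II.4] -/
theorem typeClassesBotTransport :
    ∀ (r₁ r₂ : GKIrrep G21), GKIrrClass.mk r₁ = GKIrrClass.mk r₂ →
      ∀ (n : ℕ) (δ : ℤ), upqTypeClasses r₁.ρK r₁.ρ𝔤 r₁.isGKModule.ad_compat n δ = ⊥ →
        upqTypeClasses r₂.ρK r₂.ρ𝔤 r₂.isGKModule.ad_compat n δ = ⊥ := by
  intro r₁ r₂ h n δ hbot
  obtain ⟨e⟩ := (GKIrrClass.mk_eq_mk_iff r₁ r₂).1 h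
  exact (upqTypeClasses_eq_bot_iff_of_equiv r₁.ρK r₁.ρ𝔤 r₁.isGKModule.ad_compat r₂.ρK r₂.ρ𝔤 r₂.isGKModule.ad_compat
    e.toLinearEquiv e.comm𝔤 e.commK n δ).1 hbot

/-! ## §1  Corollary: the symmetric form -/

/-- **`H^n_δ(r₁) = 0 ↔ H^n_δ(r₂) = 0` for two bundled irreducible `(𝔲(2,1), K)`-modules with the same class** (§2 in both
directions, the class equality being symmetric). [cite: BorelWallach2000, I §4.3] [cite: KnappVogan1995, §II.4] -/
theorem typeClassesBotTransport_iff (r₁ r₂ : GKIrrep G21) (h : GKIrrClass.mk r₁ = GKIrrClass.mk r₂) (n : ℕ) (δ : ℤ) :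
    upqTypeClasses r₁.ρK r₁.ρ𝔤 r₁.isGKModule.ad_compat n δ = ⊥ ↔
      upqTypeClasses r₂.ρK r₂.ρ𝔤 r₂.isGKModule.ad_compat n δ = ⊥ :=
  ⟨typeClassesBotTransport r₁ r₂ h n δ, typeClassesBotTransport r₂ r₁ h.symm n δ⟩

end Summit.HodgeConjecture.HodgeConjecture.Cruxes.H413.K2E1bTypeClassesBotTransport

end
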